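import Literature.Computability.AlgebraicComplexity.LR17EquivariantQuadricProofs
import Literature.Computability.AlgebraicComplexity.ABV17SingularLocusBound
import HarnessLib

/-!
# Landsberg–Ressayre 2017, Prop. 2.11, the LOWER bound `edc(Q) ≥ M + 1`: `lr_prop_2_11_ge` holds

Topic `Literature/Computability/AlgebraicComplexity`.  DISCHARGE of the named fact `lr_prop_2_11_ge`
of `LR17EquivariantRepresentations.lean` (LR17 Prop. 2.11, p0006:L99–L105, proof p0011:L26–L76; in
the tree's corrected range `M ≥ 5`, see the fact's docstring): every `𝔾_Q`-equivariant (exact lifts)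
affine determinantal representation `Ã` of a nondegenerate quadratic form `Q` in `M ≥ 5` variables
over `ℂ` has size `n ≥ M + 1`.

## The printed proof and the proof here

Printed (p0011:L26–L76): "By Lemma 3.2, one may assume that `Ã(0) = Λ_{n-1}`" (regularity, from
`codim {Q = 0}_sing = M ≥ 5`, and the normal form); the identity component of `ρ̄_A⁻¹(𝔾_Q)` has a
Levi factor `L` mapping onto `𝔾_Q° = ℂ* × SO(Q)`; "`A(V)` is an irreducible `L`-module"; its
projection to `ℓ₁* ⊗ ℓ₂` (the `(1,1)` entry) vanishes, its projection to `ℓ₁* ⊗ ℍ` (the rest of the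
first column) "must be non-zero … Since it is equivariant, `ℓ₁* ⊗ ℍ ≃ ℍ` must contain `V` as an
`L`-module", so `dim ℍ = n - 1 ≥ dim V = M`.

Here, step by step:
* REGULARITY `rank Ã(0) = n - 1` is the tree's ABV Prop. 2.1
  (`alperBogartVelasco2017_prop_2_1_rank_zero`: any determinantal expression of a form `f` with
  `codim Sing(f) > 4`), fed with `codim Sing(Q) = M ≥ 5` (`LR17Quadric.four_lt_height_singIdeal`:
  the partials `2(Sx)_l` of `Q = xᵀSx` span all the variables) — this is LR's Lemma 3.2 (von zur
  Gathen) for the quadric; NORMAL FORM `V Ã(0) U = Λ_{i₀}` (`exists_mul_mul_eq_lamMatrix`, LR §3.3);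
* "the `(1,1)` entry of `A(V)` is zero": the linear term of `det(V Ã U) = det V det U · Q` vanishes,
  and it is the `(i₀,i₀)` entry of the linear part (`AlperBogartVelasco.constantCoeff_pderiv_det`);
  in invariant terms `w · A_i v = 0` for `v = U e_{i₀} ∈ ker Λ`, `w = Vᵀ e_{i₀}` (inline, `hwAv`);
* "the projection of `A(V)` to `ℓ₁* ⊗ ℍ`" is the linear map `c : x ↦ A(x)v = Σ_i x_i A_i v`; it is
  EQUIVARIANT in the elementary sense that its kernel is stable under `x ↦ xγ` for every `γ ∈ 𝔾_Q`
  (exact lifts `Ã(γ·x) = g Ã(x) h⁻¹` give `g Λ = Λ h`, so `h⁻¹` preserves the kernel LINE `ℂv`, and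
  `Σ_i γ_{wi} A_i = g A_w h⁻¹`; `LR17Quadric.ker_stable`), and its kernel lies in the cone `{Q = 0}`
  (`Ã(x) v = 0 ⇒ Q(x) = det Ã(x) = 0`; `LR17Quadric.eval_eq_zero_of_ker`);
* IRREDUCIBILITY of `V` under `L` is replaced by REFLECTIONS: for `x₀ ≠ 0` in the kernel pick `u`
  with `Q(u) ≠ 0` and `B(u, x₀) ≠ 0` (`Q · B(·, x₀)` is a non-zero polynomial, `ℂ` is infinite); the
  reflection `r_u ∈ O(Q) ≤ 𝔾_Q` (`LR17Quadric.reflection_mem_projLinStabilizer`) moves `x₀` by a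
  non-zero multiple of `u`, so `u` lies in the kernel, hence in the cone — contradicting `Q(u) ≠ 0`.
  So `c` is injective ("must be non-zero … contains `V`");
* the count: `M = rank [c] = rank [V·c] ≤ rank Λ_{i₀} = n - 1`, the matrix `V·[c]` having its
  `i₀`-th row `(w · A_i v)_i = 0`.

Everything is proved; no named facts, no new definitions.  Honest framing: a published lower bound
for EQUIVARIANT representations of quadrics; nothing here bears on `dc` without symmetry or on
VP versus VNP.

## References

* J. M. Landsberg, N. Ressayre, *Permanent v. determinant: an exponential lower bound assuming
  symmetry and a potential path towards Valiant's conjecture*, Differential Geom. Appl. 55 (2017)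
  146–166, arXiv:1508.05788: Prop. 2.11 (p0006:L99–L105), its proof §3.6 (p0011:L26–L76),
  Lemma 3.2, §3.3 (normal form).
* J. Alper, T. Bogart, M. Velasco, *A lower bound for the determinantal complexity of a
  hypersurface*, Found. Comput. Math. 17 (2017), Prop. 2.1 (tree: `alperBogartVelasco2017_prop_2_1_rank_zero`).
-/

noncomputable section

open MvPolynomial Matrix Finset

namespace Literature.Computability.AlgebraicComplexity

namespace LR17Quadric

open LRPencil AlperBogartVelasco VonZurGathen

variable {M : ℕ}

/-! ### The quadratic form `Q_S = Σ S_ij x_i x_j`: value, homogeneity, singular ideal -/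

/-- `Q_S(x) = x · S x` (the quadratic form with Gram matrix `S`; p0004:L1).
[cite: LandsbergRessayre2017, Example 1.4] -/
theorem eval_quadForm (S : Matrix (Fin M) (Fin M) ℂ) (x : Fin M → ℂ) :
    eval x (∑ i, ∑ j, C (S i j) * (X i * X j) : MvPolynomial (Fin M) ℂ) = x ⬝ᵥ (S *ᵥ x) := by
  simp only [map_sum, map_mul, eval_C, eval_X, dotProduct, mulVec, Finset.mul_sum]
  exact Finset.sum_congr rfl fun i _ => Finset.sum_congr rfl fun j _ => by ring

/-- `Q_S ∈ S²ℂ^{M*}` is homogeneous of degree `2` (p0006:L100). [cite: LandsbergRessayre2017, Prop. 2.11] -/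
theorem isHomogeneous_quadForm (S : Matrix (Fin M) (Fin M) ℂ) :
    (∑ i, ∑ j, C (S i j) * (X i * X j) : MvPolynomial (Fin M) ℂ).IsHomogeneous 2 :=
  IsHomogeneous.sum _ _ _ fun i _ => IsHomogeneous.sum _ _ _ fun j _ =>
    ((isHomogeneous_X ℂ i).mul (isHomogeneous_X ℂ j)).C_mul _

/-- `∂/∂x_l (Σ_{ij} S_{ij} x_i x_j) = Σ_j S_{lj} x_j + Σ_i S_{il} x_i` (as in the companion file
`LR17EquivariantQuadricProofs`, where it is private). [folklore] -/
private theorem pderiv_quadForm (S : Matrix (Fin M) (Fin M) ℂ) (l : Fin M) :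
    pderiv l (∑ i, ∑ j, C (S i j) * (X i * X j) : MvPolynomial (Fin M) ℂ) =
      ∑ j, C (S l j) * X j + ∑ i, C (S i l) * X i := by
  have hterm : ∀ i j : Fin M, pderiv l (C (S i j) * (X i * X j) : MvPolynomial (Fin M) ℂ) =
      (if i = l then C (S i j) * X j else 0) + (if j = l then C (S i j) * X i else 0) := by
    intro i j
    rw [pderiv_C_mul, pderiv_mul, pderiv_X, pderiv_X, Pi.single_apply, Pi.single_apply]
    split_ifs <;> ring
  simp_rw [map_sum, hterm, Finset.sum_add_distrib]
  congr 1
  · rw [Finset.sum_comm]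
    simp only [Finset.sum_ite_eq', Finset.mem_univ, if_true]
  · simp only [Finset.sum_ite_eq', Finset.mem_univ, if_true]

/-- For symmetric `S`: `∂Q_S/∂x_l = Σ_j 2 S_{lj} x_j`. [folklore] -/
private theorem pderiv_quadForm_of_isSymm {S : Matrix (Fin M) (Fin M) ℂ} (hS : S.IsSymm) (l : Fin M) :
    pderiv l (∑ i, ∑ j, C (S i j) * (X i * X j) : MvPolynomial (Fin M) ℂ) =
      ∑ j, C (2 * S l j) * X j := by
  rw [pderiv_quadForm, ← Finset.sum_add_distrib]
  exact Finset.sum_congr rfl fun j _ => by rw [hS.apply j l, map_mul, map_ofNat]; ring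

/-- For `S` symmetric with `det S` a unit, EVERY variable lies in the singular ideal of `Q_S`
(`x = (2S)⁻¹ ∇Q_S`): the cone `{Q_S = 0}` is singular only at the origin ("a smooth quadric",
p0006:L121). [cite: LandsbergRessayre2017, §2.5] -/
theorem X_mem_singIdeal {S : Matrix (Fin M) (Fin M) ℂ} (hS : S.IsSymm) (hdet : IsUnit S.det)
    (a : Fin M) :
    (X a : MvPolynomial (Fin M) ℂ) ∈ singIdeal (∑ i, ∑ j, C (S i j) * (X i * X j)) := by
  set Q : MvPolynomial (Fin M) ℂ := ∑ i, ∑ j, C (S i j) * (X i * X j) with hQ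
  -- `Σ_l (S⁻¹)_{al}/2 · ∂_l Q = X_a`
  have hsum : ∑ l, C ((S⁻¹) a l / 2) * pderiv l Q = X a := by
    have h2 : ∀ l, pderiv l Q = ∑ j, C (2 * S l j) * X j := fun l => by
      rw [hQ, pderiv_quadForm_of_isSymm hS]
    simp_rw [h2, Finset.mul_sum, ← mul_assoc, ← map_mul]
    rw [Finset.sum_comm]
    have hcoef : ∀ j, ∑ l, C ((S⁻¹) a l / 2 * (2 * S l j)) * (X j : MvPolynomial (Fin M) ℂ) =
        C ((S⁻¹ * S) a j) * X j := fun j => by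
      rw [← Finset.sum_mul, ← map_sum, Matrix.mul_apply]
      congr 2
      exact Finset.sum_congr rfl fun l _ => by ring
    simp_rw [hcoef, Matrix.nonsing_inv_mul S hdet, Matrix.one_apply]
    rw [Finset.sum_eq_single a]
    · simp
    · intro j _ hj; simp [Ne.symm hj]
    · intro h; exact absurd (Finset.mem_univ a) h
  rw [← hsum]
  exact Ideal.sum_mem _ fun l _ => Ideal.mul_mem_left _ _ (pderiv_mem_singIdeal Q l)

/-- **`codim Sing(Q) = M`**, the input of LR17 Lemma 3.2 for a nondegenerate quadric (p0006:L121–L122: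
"Any determinantal representation of … a smooth quadric is regular"): every prime over the singular
ideal contains all the variables, hence has height `≥ M`; so `M ≥ 5 ⇒ codim Sing(Q) > 4`.
[cite: LandsbergRessayre2017, Lemma 3.2] -/
theorem four_lt_height_singIdeal {S : Matrix (Fin M) (Fin M) ℂ} (hS : S.IsSymm) (hdet : IsUnit S.det)
    (hM : 5 ≤ M) :
    4 < (singIdeal (∑ i, ∑ j, C (S i j) * (X i * X j) : MvPolynomial (Fin M) ℂ)).height := by
  classical
  have hle : (M : ℕ∞) ≤ (singIdeal (∑ i, ∑ j, C (S i j) * (X i * X j) : MvPolynomial (Fin M) ℂ)).height := by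
    rw [Ideal.height_eq_inf_minimalPrimes]
    refine le_iInf₂ fun P hP => ?_
    haveI := hP.1.1
    -- `ker (f ↦ f(0)) ≤ P`
    have hker : RingHom.ker (aeval (R := ℂ) (0 : Fin M → ℂ)) ≤ P := by
      intro p hp
      rw [RingHom.mem_ker, aeval_zero, Algebra.algebraMap_self, RingHom.id_apply] at hp
      have hmem : p ∈ Ideal.span ((X : Fin M → MvPolynomial (Fin M) ℂ) '' Set.univ) := by
        rw [mem_ideal_span_X_image]
        intro m hm
        have hm0 : m ≠ 0 := by
          rintro rfl
          exact (mem_support_iff.1 hm) (by rwa [← constantCoeff_eq])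
        obtain ⟨i, hi⟩ := Finsupp.ne_iff.1 hm0
        exact ⟨i, Set.mem_univ _, hi⟩
      refine Ideal.span_le.2 ?_ hmem
      rintro _ ⟨i, -, rfl⟩
      exact hP.1.2 (X_mem_singIdeal hS hdet i)
    calc (M : ℕ∞) = ((Finset.univ : Finset (Fin M)).card : ℕ∞) := by rw [Finset.card_univ, Fintype.card_fin]
      _ ≤ (RingHom.ker (aeval (R := ℂ) (0 : Fin M → ℂ))).height :=
          card_le_height_ker_aeval (K := ℂ) (0 : Fin M → ℂ) Finset.univ fun _ _ => rfl
      _ ≤ P.height := Ideal.height_mono hker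
  exact lt_of_lt_of_le (by exact_mod_cast (by omega : 4 < M)) hle

/-! ### Reflections of a nondegenerate quadratic form -/

section Reflection

variable {S : Matrix (Fin M) (Fin M) ℂ} {u : Fin M → ℂ}

/-- The scalar identity behind `r_u² = 1` and `r_u ∈ O(Q)`: `(2/q)² q - 2 (2/q) = 0`. [folklore] -/
private theorem refl_scalar {q : ℂ} (hq : q ≠ 0) : (2 / q) * (2 / q) * q - 2 * (2 / q) = 0 := by
  field_simp
  ring

/-- The (transposed) reflection matrix `G_u = 1 - (2/Q(u)) (Su) uᵀ` squares to the identity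
(reflections are involutions of the orthogonal group `O(Q) ≤ 𝔾_Q`, p0004:L2–L3).
[cite: LandsbergRessayre2017, Example 1.4] -/
theorem reflection_mul_self (hq : u ⬝ᵥ (S *ᵥ u) ≠ 0) :
    ((1 : Matrix (Fin M) (Fin M) ℂ) - (2 / (u ⬝ᵥ (S *ᵥ u))) • vecMulVec (S *ᵥ u) u) *
      ((1 : Matrix (Fin M) (Fin M) ℂ) - (2 / (u ⬝ᵥ (S *ᵥ u))) • vecMulVec (S *ᵥ u) u) = 1 := by
  set q := u ⬝ᵥ (S *ᵥ u) with hqdef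
  set α := 2 / q with hα
  set W := vecMulVec (S *ᵥ u) u with hW
  have hWW : W * W = q • W := by
    rw [hW, vecMulVec_mul_vecMulVec, vecMulVec_smul, hqdef]
  have h : ((1 : Matrix (Fin M) (Fin M) ℂ) - α • W) * (1 - α • W) = 1 + (α * α * q - 2 * α) • W := by
    rw [sub_mul, Matrix.one_mul, mul_sub, Matrix.mul_one, Matrix.smul_mul, Matrix.mul_smul, hWW,
      smul_smul, smul_smul, sub_smul, mul_smul (2 : ℂ) α W, two_smul]
    abel
  rw [h, refl_scalar hq, zero_smul, add_zero]

/-- `G_u S G_uᵀ = S`: `x ↦ x G_u` is an isometry of `Q_S` (`S` symmetric), i.e. `G_u ∈ O(Q)`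
(p0004:L2–L3). [cite: LandsbergRessayre2017, Example 1.4] -/
theorem reflection_mul_mul_transpose (hS : S.IsSymm) (hq : u ⬝ᵥ (S *ᵥ u) ≠ 0) :
    ((1 : Matrix (Fin M) (Fin M) ℂ) - (2 / (u ⬝ᵥ (S *ᵥ u))) • vecMulVec (S *ᵥ u) u) * S *
      ((1 : Matrix (Fin M) (Fin M) ℂ) - (2 / (u ⬝ᵥ (S *ᵥ u))) • vecMulVec (S *ᵥ u) u)ᵀ = S := by
  set q := u ⬝ᵥ (S *ᵥ u) with hqdef
  set α := 2 / q with hα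
  set W := vecMulVec (S *ᵥ u) u with hW
  set Z := vecMulVec (S *ᵥ u) (S *ᵥ u) with hZ
  have huS : u ᵥ* S = S *ᵥ u := by rw [← Matrix.mulVec_transpose, hS.eq]
  have hWS : W * S = Z := by rw [hW, vecMulVec_mul, huS]
  have hSWt : S * Wᵀ = Z := by rw [hW, transpose_vecMulVec, mul_vecMulVec]
  have hWSWt : W * S * Wᵀ = q • Z := by
    rw [hWS, hW, transpose_vecMulVec, hZ, vecMulVec_mul_vecMulVec, vecMulVec_smul, dotProduct_comm,
      hqdef]
  have h : ((1 : Matrix (Fin M) (Fin M) ℂ) - α • W) * S * (1 - α • W)ᵀ = S + (α * α * q - 2 * α) • Z := by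
    rw [transpose_sub, transpose_one, transpose_smul, sub_mul, Matrix.one_mul, Matrix.smul_mul,
      mul_sub, Matrix.mul_one, Matrix.mul_smul, sub_mul, hSWt, Matrix.smul_mul, hWSWt, hWS,
      smul_sub, smul_smul, smul_smul, sub_smul, mul_smul (2 : ℂ) α Z, two_smul]
    abel
  rw [h, refl_scalar hq, zero_smul, add_zero]

/-- `x G_u = x - (2 B(x,u)/Q(u)) u`, `B(x,u) = x · S u`: the reflection in the hyperplane
`S`-orthogonal to `u` (an element of `O(Q)`, p0004:L2–L3). [cite: LandsbergRessayre2017, Example 1.4] -/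
theorem vecMul_reflection (x : Fin M → ℂ) :
    x ᵥ* ((1 : Matrix (Fin M) (Fin M) ℂ) - (2 / (u ⬝ᵥ (S *ᵥ u))) • vecMulVec (S *ᵥ u) u) =
      x - (2 / (u ⬝ᵥ (S *ᵥ u)) * (x ⬝ᵥ (S *ᵥ u))) • u := by
  rw [vecMul_sub, vecMul_one, vecMul_smul, vecMul_vecMulVec, smul_smul]

/-- **Reflections are symmetries of the quadric**: `G_u ∈ 𝔾_{Q_S}` (indeed `G_u · Q_S = Q_S`), for
`S` symmetric and `Q_S(u) ≠ 0` (the orthogonal group inside LR's `𝔾_Q = ℂ* × O(Q)`, p0004:L6).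
[cite: LandsbergRessayre2017, Example 1.4] -/
theorem reflection_mem_projLinStabilizer (hS : S.IsSymm) (hq : u ⬝ᵥ (S *ᵥ u) ≠ 0) :
    (⟨(1 : Matrix (Fin M) (Fin M) ℂ) - (2 / (u ⬝ᵥ (S *ᵥ u))) • vecMulVec (S *ᵥ u) u,
      (1 : Matrix (Fin M) (Fin M) ℂ) - (2 / (u ⬝ᵥ (S *ᵥ u))) • vecMulVec (S *ᵥ u) u,
      reflection_mul_self hq, reflection_mul_self hq⟩ : GL (Fin M) ℂ) ∈
      projLinStabilizer (∑ i, ∑ j, C (S i j) * (X i * X j) : MvPolynomial (Fin M) ℂ) := by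
  refine mem_projLinStabilizer.2 ⟨1, ?_⟩
  rw [linSubstRep_apply, Units.val_one, one_smul]
  show linSubst (Fin M) ℂ ((1 : Matrix (Fin M) (Fin M) ℂ) - (2 / (u ⬝ᵥ (S *ᵥ u))) • vecMulVec (S *ᵥ u) u)
    (∑ i, ∑ j, C (S i j) * (X i * X j)) = _
  rw [linSubst_quadForm, reflection_mul_mul_transpose hS hq]

end Reflection

/-! ### The map `x ↦ Ã(x) v` (`v ∈ ker Λ`): its kernel is `𝔾_Q`-stable and lies in the cone -/

section Kernel

variable {n : ℕ} {f : MvPolynomial (Fin M) ℂ} {A : Matrix (Fin n) (Fin n) (MvPolynomial (Fin M) ℂ)}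

/-- `(Σ_w c_w N_w) v = Σ_w c_w (N_w v)`. [folklore] -/
private theorem sum_smul_mulVec {ι : Type*} (s : Finset ι) (c : ι → ℂ)
    (N : ι → Matrix (Fin n) (Fin n) ℂ) (v : Fin n → ℂ) :
    (∑ w ∈ s, c w • N w) *ᵥ v = ∑ w ∈ s, c w • (N w *ᵥ v) := by
  induction s using Finset.cons_induction with
  | empty => simp
  | cons a s ha ih => rw [Finset.sum_cons, Finset.sum_cons, add_mulVec, smul_mulVec, ih]

/-- `N (Σ_w c_w y_w) = Σ_w c_w N y_w`. [folklore] -/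
private theorem mulVec_sum_smul {ι : Type*} (s : Finset ι) (c : ι → ℂ) (N : Matrix (Fin n) (Fin n) ℂ)
    (y : ι → Fin n → ℂ) : N *ᵥ (∑ w ∈ s, c w • y w) = ∑ w ∈ s, c w • (N *ᵥ y w) := by
  have : ∀ z, N *ᵥ z = N.mulVecLin z := fun z => rfl
  simp_rw [this, map_sum, map_smul]

/-- **The cone**: if `Ã(x) v = 0` for a non-zero `v ∈ ker Λ` (i.e. `x ∈ ker c`), then
`f(x) = det Ã(x) = 0`. [cite: LandsbergRessayre2017, Prop. 2.11 (proof)] -/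
theorem eval_eq_zero_of_ker (hA : IsAffineDetRepr f A) {v : Fin n → ℂ} (hv0 : v ≠ 0)
    (hΛv : constPart A *ᵥ v = 0) {x : Fin M → ℂ}
    (hx : (∑ i, x i • coeffMat A i) *ᵥ v = 0) : eval x f = 0 := by
  classical
  have hAx : (A.map (eval x)) *ᵥ v = 0 := by
    rw [map_eval_eq A hA.1 x, add_mulVec, hΛv, hx, add_zero]
  have hdet : (A.map (eval x)).det = 0 := (Matrix.exists_mulVec_eq_zero_iff).1 ⟨v, hv0, hAx⟩
  rw [← hA.2, RingHom.map_det, RingHom.mapMatrix_apply]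
  exact hdet

/-- **Equivariance of `c : x ↦ Ã(x) v`**: for a REGULAR `Γ`-equivariant representation and
`v ∈ ker Λ`, the kernel of `c` is stable under `x ↦ x γ`, `γ ∈ Γ` (exact lifts: `g Λ = Λ h`, so
`h⁻¹ v ∈ ker Λ = ℂ v`, and `Σ_i γ_{wi} A_i = g A_w h⁻¹`). [cite: LandsbergRessayre2017, Prop. 2.11 (proof)] -/
theorem ker_stable {Γ : Subgroup (GL (Fin M) ℂ)} (hA : IsEquivariantDetRepr Γ f A) (hn : 0 < n)
    (hrank : (constPart A).rank = n - 1) {v : Fin n → ℂ} (hv0 : v ≠ 0)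
    (hΛv : constPart A *ᵥ v = 0) {γ : GL (Fin M) ℂ} (hγ : γ ∈ Γ) {x : Fin M → ℂ}
    (hx : (∑ i, x i • coeffMat A i) *ᵥ v = 0) :
    (∑ i, (x ᵥ* (γ : Matrix (Fin M) (Fin M) ℂ)) i • coeffMat A i) *ᵥ v = 0 := by
  classical
  obtain ⟨g, h, hgh, hgΛ⟩ := hA.exists_lift_stabilising hγ
  set Λ := constPart A with hΛ
  -- the coefficient matrices transform by the lift
  have hcoef : ∀ w, ∑ i, (γ : Matrix (Fin M) (Fin M) ℂ) w i • coeffMat A i =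
      (g : Matrix (Fin n) (Fin n) ℂ) * coeffMat A w * ((h⁻¹ : GL (Fin n) ℂ) : Matrix (Fin n) (Fin n) ℂ) := by
    intro w
    have e := congrArg (fun B => coeffMat B w) hgh
    rwa [coeffMat_linSubstEntries _ _ hA.1.1, coeffMat_C_mul_mul_C] at e
  -- `h⁻¹ v ∈ ker Λ`
  have hΛh : Λ * ((h⁻¹ : GL (Fin n) ℂ) : Matrix (Fin n) (Fin n) ℂ) =
      ((g⁻¹ : GL (Fin n) ℂ) : Matrix (Fin n) (Fin n) ℂ) * Λ := by
    calc Λ * ((h⁻¹ : GL (Fin n) ℂ) : Matrix (Fin n) (Fin n) ℂ)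
        = ((g⁻¹ : GL (Fin n) ℂ) : Matrix (Fin n) (Fin n) ℂ) * ((g : Matrix (Fin n) (Fin n) ℂ) * Λ) *
            ((h⁻¹ : GL (Fin n) ℂ) : Matrix (Fin n) (Fin n) ℂ) := by
          rw [← Matrix.mul_assoc, ← Units.val_mul, inv_mul_cancel, Units.val_one, Matrix.one_mul]
      _ = ((g⁻¹ : GL (Fin n) ℂ) : Matrix (Fin n) (Fin n) ℂ) * Λ := by
          rw [hgΛ, Matrix.mul_assoc, Matrix.mul_assoc, ← Units.val_mul, mul_inv_cancel,
            Units.val_one, Matrix.mul_one]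
  have hhv : Λ *ᵥ (((h⁻¹ : GL (Fin n) ℂ) : Matrix (Fin n) (Fin n) ℂ) *ᵥ v) = 0 := by
    rw [mulVec_mulVec, hΛh, ← mulVec_mulVec, hΛv, mulVec_zero]
  -- `ker Λ` is the line `ℂ v`
  have hK : Module.finrank ℂ (LinearMap.ker (Matrix.toLin' Λ)) = 1 := by
    have h1 := LinearMap.finrank_range_add_finrank_ker (Matrix.toLin' Λ)
    rw [Module.finrank_fin_fun] at h1
    have h2 : Module.finrank ℂ (LinearMap.range (Matrix.toLin' Λ)) = n - 1 := by
      rw [Matrix.toLin'_apply']; exact hrank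
    omega
  have hvK : v ∈ LinearMap.ker (Matrix.toLin' Λ) := by
    rw [LinearMap.mem_ker, Matrix.toLin'_apply]; exact hΛv
  have hvK0 : (⟨v, hvK⟩ : LinearMap.ker (Matrix.toLin' Λ)) ≠ 0 := fun e =>
    hv0 (congrArg Subtype.val e)
  obtain ⟨μ, hμ⟩ := (finrank_eq_one_iff_of_nonzero' _ hvK0).1 hK
    ⟨((h⁻¹ : GL (Fin n) ℂ) : Matrix (Fin n) (Fin n) ℂ) *ᵥ v, by
      rw [LinearMap.mem_ker, Matrix.toLin'_apply]; exact hhv⟩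
  have hμ' : ((h⁻¹ : GL (Fin n) ℂ) : Matrix (Fin n) (Fin n) ℂ) *ᵥ v = μ • v := by
    have := congrArg Subtype.val hμ
    simpa using this.symm
  -- compute
  have hsum : ∑ i, (x ᵥ* (γ : Matrix (Fin M) (Fin M) ℂ)) i • coeffMat A i =
      ∑ w, x w • ((g : Matrix (Fin n) (Fin n) ℂ) * coeffMat A w *
        ((h⁻¹ : GL (Fin n) ℂ) : Matrix (Fin n) (Fin n) ℂ)) := by
    simp_rw [← hcoef, Finset.smul_sum, smul_smul, vecMul, dotProduct, Finset.sum_smul]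
    rw [Finset.sum_comm]
  rw [hsum, sum_smul_mulVec]
  have hterm : ∀ w, ((g : Matrix (Fin n) (Fin n) ℂ) * coeffMat A w *
      ((h⁻¹ : GL (Fin n) ℂ) : Matrix (Fin n) (Fin n) ℂ)) *ᵥ v =
      μ • ((g : Matrix (Fin n) (Fin n) ℂ) *ᵥ (coeffMat A w *ᵥ v)) := by
    intro w
    rw [← mulVec_mulVec, ← mulVec_mulVec, hμ', mulVec_smul, mulVec_smul]
  simp_rw [hterm, smul_comm (x _) μ]
  rw [← Finset.smul_sum, ← mulVec_sum_smul, ← sum_smul_mulVec, hx, mulVec_zero, smul_zero]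

end Kernel

end LR17Quadric

/-! ## The named fact holds -/

open LR17Quadric LRPencil AlperBogartVelasco VonZurGathen in
/-- **LR17 Prop. 2.11, lower bound — DISCHARGED** (p0006:L99–L105 with the tree's range correction
`M ≥ 5`): every affine determinantal representation of a nondegenerate quadratic form `Q` in `M ≥ 5`
variables over `ℂ` which is equivariant (exact lifts) for `𝔾_Q` has size `n ≥ M + 1`.
[cite: LandsbergRessayre2017, Prop. 2.11] -/
theorem lr_prop_2_11_ge_holds : lr_prop_2_11_ge := by
  intro M hM Q hQ n A hA
  obtain ⟨S, hS, hSdet, rfl⟩ := hQ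
  classical
  set Q : MvPolynomial (Fin M) ℂ := ∑ i, ∑ j, C (S i j) * (X i * X j) with hQdef
  have haff : ∀ r c, (A r c).totalDegree ≤ 1 := hA.1.1
  have hdet : A.det = Q := hA.1.2
  have hhom : Q.IsHomogeneous 2 := isHomogeneous_quadForm S
  have h4 : 4 < (singIdeal Q).height := four_lt_height_singIdeal hS hSdet hM
  -- regularity (LR Lemma 3.2 via ABV Prop. 2.1) and `n ≥ 1`
  have hrk : (constPart A).rank + 1 = n :=
    alperBogartVelasco2017_prop_2_1_rank_zero hhom two_ne_zero h4 A hdet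
  have hn : 0 < n := by omega
  have hrank : (constPart A).rank = n - 1 := by omega
  -- normal form `V Λ U = Λ_{i₀}`
  obtain ⟨V, U, i₀, hV, hU, hVU⟩ :=
    exists_mul_mul_eq_lamMatrix (constPart A) (by rw [Fintype.card_fin]; exact hrank)
      (by rw [Fintype.card_fin]; exact hn)
  have hVd : IsUnit V.det := (Matrix.isUnit_iff_isUnit_det V).1 hV
  have hUd : IsUnit U.det := (Matrix.isUnit_iff_isUnit_det U).1 hU
  set Λ := constPart A with hΛ
  -- `v = U e_{i₀}` spans `ker Λ`, `w = Vᵀ e_{i₀}`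
  set v : Fin n → ℂ := fun r => U r i₀ with hv
  set w : Fin n → ℂ := fun r => V i₀ r with hw
  have hUe : U *ᵥ Pi.single i₀ 1 = v := by
    ext r; rw [Matrix.mulVec_single_one]; rfl
  have hv0 : v ≠ 0 := by
    intro h0
    have h1 : ∃ y ≠ 0, U *ᵥ y = 0 := ⟨Pi.single i₀ 1, by simp, by rw [hUe, h0]⟩
    exact hUd.ne_zero ((Matrix.exists_mulVec_eq_zero_iff).1 h1)
  have hΛv : Λ *ᵥ v = 0 := by
    have h1 : (V * Λ * U) *ᵥ Pi.single i₀ 1 = 0 := by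
      rw [hVU]; ext r; rw [Matrix.mulVec_single_one, Matrix.col_apply, lamMatrix_apply]; simp
    rw [← mulVec_mulVec, ← mulVec_mulVec, hUe] at h1
    have hinj : Function.Injective V.mulVec := Matrix.mulVec_injective_iff_isUnit.2 hV
    exact hinj (by rw [h1, mulVec_zero])
  -- the linear term of `det (V Ã U)` vanishes: `w · A_i v = 0`
  set B : Matrix (Fin n) (Fin n) (MvPolynomial (Fin M) ℂ) := V.map C * A * U.map C with hB
  have hB0 : constPart B = lamMatrix ℂ i₀ := by
    rw [hB, constPart_mul, constPart_mul, constPart_map_C, constPart_map_C, hVU]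
  have hB1 : ∀ r j, (B r j).totalDegree ≤ 1 := by
    intro r j
    rw [hB, Matrix.mul_apply]
    refine totalDegree_finsetSum_le fun l _ => ?_
    rw [Matrix.mul_apply, Matrix.map_apply]
    refine (totalDegree_mul _ _).trans ?_
    rw [totalDegree_C, add_zero]
    refine totalDegree_finsetSum_le fun k _ => ?_
    rw [Matrix.map_apply]
    refine (totalDegree_mul _ _).trans ?_
    rw [totalDegree_C, zero_add]
    exact haff k l
  have hdetB : B.det = C (V.det * U.det) * Q := by
    have hVd' : (V.map (C : ℂ →+* MvPolynomial (Fin M) ℂ)).det = C V.det := by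
      rw [← RingHom.mapMatrix_apply, ← RingHom.map_det]
    have hUd' : (U.map (C : ℂ →+* MvPolynomial (Fin M) ℂ)).det = C U.det := by
      rw [← RingHom.mapMatrix_apply, ← RingHom.map_det]
    rw [hB, Matrix.det_mul, Matrix.det_mul, hdet, hVd', hUd', map_mul]
    ring
  have hwAv : ∀ i, w ⬝ᵥ (coeffMat A i *ᵥ v) = 0 := by
    intro i
    have h1 : coeffMat B i i₀ i₀ = 0 := by
      rw [← constantCoeff_pderiv_det hB1 hB0 i, hdetB, pderiv_C_mul, map_mul, constantCoeff_C,
        constantCoeff_eq_zero_of_isHomogeneous hhom.pderiv (by omega), mul_zero]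
    rw [hB, coeffMat_C_mul_mul_C, Matrix.mul_assoc, Matrix.mul_apply] at h1
    rw [← h1, dotProduct]
    refine Finset.sum_congr rfl fun r _ => ?_
    rw [Matrix.mul_apply, mulVec, dotProduct]
  -- the matrix of `c : x ↦ Σ_i x_i A_i v`
  set Cm : Matrix (Fin n) (Fin M) ℂ := Matrix.of fun r i => (coeffMat A i *ᵥ v) r with hCm
  have hCmul : ∀ x : Fin M → ℂ, Cm *ᵥ x = (∑ i, x i • coeffMat A i) *ᵥ v := by
    intro x
    rw [sum_smul_mulVec]
    ext r
    simp only [hCm, mulVec, dotProduct, Matrix.of_apply, Finset.sum_apply, Pi.smul_apply, smul_eq_mul]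
    exact Finset.sum_congr rfl fun i _ => mul_comm _ _
  -- `c` is injective: reflections
  have hinj : ∀ x : Fin M → ℂ, Cm *ᵥ x = 0 → x = 0 := by
    intro x₀ hx₀
    by_contra hx₀ne
    rw [hCmul] at hx₀
    -- a vector `u` off the quadric and off the hyperplane `B(·, x₀) = 0`
    have hQ0 : Q ≠ 0 := by
      intro hQ0
      rw [hQ0] at h4
      have : singIdeal (0 : MvPolynomial (Fin M) ℂ) = ⊥ := by
        rw [singIdeal, Ideal.span_eq_bot]
        rintro p (rfl | ⟨i, rfl⟩)
        · rfl
        · exact map_zero _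
      rw [this, Ideal.height_bot] at h4
      exact absurd h4 (by decide)
    have hSx : S *ᵥ x₀ ≠ 0 := by
      intro h0
      exact hx₀ne ((Matrix.mulVec_injective_iff_isUnit.2
        ((Matrix.isUnit_iff_isUnit_det S).2 hSdet)) (by rw [h0, mulVec_zero]))
    set L : MvPolynomial (Fin M) ℂ := ∑ w, C ((S *ᵥ x₀) w) * X w with hL
    have hL0 : L ≠ 0 := by
      obtain ⟨w₀, hw₀⟩ := Function.ne_iff.1 hSx
      intro h0
      have hc : coeff (Finsupp.single w₀ 1) L = (S *ᵥ x₀) w₀ := by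
        rw [hL, coeff_sum, Finset.sum_eq_single w₀]
        · rw [coeff_C_mul, coeff_X, if_pos rfl, mul_one]
        · intro w _ hw
          rw [coeff_C_mul, coeff_X,
            if_neg (fun h => hw (Finsupp.single_left_injective one_ne_zero h)), mul_zero]
        · intro h; exact absurd (Finset.mem_univ _) h
      rw [h0, coeff_zero] at hc
      exact hw₀ hc.symm
    obtain ⟨u, hu⟩ : ∃ u : Fin M → ℂ, eval u (Q * L) ≠ 0 := by
      by_contra hall
      exact mul_ne_zero hQ0 hL0
        (MvPolynomial.funext fun u => by rw [map_zero]; exact not_not.1 fun h => hall ⟨u, h⟩)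
    rw [map_mul] at hu
    have hq : u ⬝ᵥ (S *ᵥ u) ≠ 0 := by rw [← eval_quadForm]; exact left_ne_zero_of_mul hu
    have hb : x₀ ⬝ᵥ (S *ᵥ u) ≠ 0 := by
      have h1 : eval u L = x₀ ⬝ᵥ (S *ᵥ u) := by
        rw [hL]
        simp only [map_sum, map_mul, eval_C, eval_X]
        rw [dotProduct_mulVec, ← Matrix.mulVec_transpose, hS.eq]
        rfl
      rw [← h1]; exact right_ne_zero_of_mul hu
    -- the reflection `r_u` moves `x₀` inside `ker c` by a non-zero multiple of `u`
    have hstab := ker_stable hA hn hrank hv0 hΛv (reflection_mem_projLinStabilizer hS hq) hx₀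
    change (∑ i, (x₀ ᵥ* ((1 : Matrix (Fin M) (Fin M) ℂ) -
      (2 / (u ⬝ᵥ (S *ᵥ u))) • vecMulVec (S *ᵥ u) u)) i • coeffMat A i) *ᵥ v = 0 at hstab
    rw [vecMul_reflection] at hstab
    have hu_ker : (∑ i, u i • coeffMat A i) *ᵥ v = 0 := by
      have hβ : (2 / (u ⬝ᵥ (S *ᵥ u)) * (x₀ ⬝ᵥ (S *ᵥ u))) ≠ 0 :=
        mul_ne_zero (div_ne_zero two_ne_zero hq) hb
      have h1 : (∑ i, (x₀ - (2 / (u ⬝ᵥ (S *ᵥ u)) * (x₀ ⬝ᵥ (S *ᵥ u))) • u) i • coeffMat A i) *ᵥ v =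
          (∑ i, x₀ i • coeffMat A i) *ᵥ v -
            (2 / (u ⬝ᵥ (S *ᵥ u)) * (x₀ ⬝ᵥ (S *ᵥ u))) • ((∑ i, u i • coeffMat A i) *ᵥ v) := by
        rw [← hCmul, ← hCmul, ← hCmul, mulVec_sub, mulVec_smul]
      rw [h1, hx₀, zero_sub, neg_eq_zero, smul_eq_zero] at hstab
      exact hstab.resolve_left hβ
    have hQu : eval u Q = 0 := eval_eq_zero_of_ker hA.1 hv0 hΛv hu_ker
    exact hq (by rw [← eval_quadForm]; exact hQu)
  -- the count: `M = rank Cm = rank (V Cm) ≤ rank Λ_{i₀} = n - 1`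
  have hrankC : Cm.rank = M := by
    have hker : LinearMap.ker Cm.mulVecLin = ⊥ :=
      LinearMap.ker_eq_bot'.2 fun x hx => hinj x hx
    have h1 := LinearMap.finrank_range_add_finrank_ker Cm.mulVecLin
    rw [hker, finrank_bot, add_zero, Module.finrank_fin_fun] at h1
    exact h1
  have hrow : ∀ i, (V * Cm) i₀ i = 0 := by
    intro i
    rw [Matrix.mul_apply, ← hwAv i, dotProduct]
    rfl
  have hVC : V * Cm = lamMatrix ℂ i₀ * (V * Cm) := by
    ext r i
    rw [lamMatrix, Matrix.diagonal_mul]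
    by_cases hr : r = i₀
    · subst hr; rw [hrow]; simp
    · simp [hr]
  have hle : M ≤ n - 1 := by
    calc M = Cm.rank := hrankC.symm
      _ = (V * Cm).rank := (Matrix.rank_mul_eq_right_of_isUnit_det V Cm hVd).symm
      _ = (lamMatrix ℂ i₀ * (V * Cm)).rank := by rw [← hVC]
      _ ≤ (lamMatrix ℂ i₀).rank := Matrix.rank_mul_le_left _ _
      _ = n - 1 := by rw [rank_lamMatrix, Fintype.card_fin]
  omega

/-- **LR17 Prop. 2.11 in full, UNCONDITIONAL** (p0006:L99–L105, in the tree's corrected range `M ≥ 5`):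
`edc_{𝔾_Q}(Q) = M + 1` for every nondegenerate quadratic form `Q` in `M ≥ 5` variables over `ℂ` — the
statement file's `lr_prop_2_11_eq` fed with the two discharges `lr_prop_2_11_le_holds`
(`LR17EquivariantQuadricProofs.lean`) and `lr_prop_2_11_ge_holds` (above).
[cite: LandsbergRessayre2017, Prop. 2.11] -/
theorem LR17.equivariantDetComplexity_quadric_eq {M : ℕ} (hM : 5 ≤ M) {Q : MvPolynomial (Fin M) ℂ}
    (hQ : IsNondegQuadraticForm Q) : equivariantDetComplexity (projLinStabilizer Q) Q = M + 1 :=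
  lr_prop_2_11_eq lr_prop_2_11_le_holds lr_prop_2_11_ge_holds hM hQ

end Literature.Computability.AlgebraicComplexity
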